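import Summits.BirchSwinnertonDyer.BirchSwinnertonDyer.Theorems.Rank2Observatory2DescKillSig2XCoreE
import Summits.BirchSwinnertonDyer.BirchSwinnertonDyer.Theorems.Rank2Observatory2DescKillSig8Core
import HarnessLib

/-!
# KERNEL-2DESC — the 2-ADIC signature certificate for ONE `ℤ₂`-root + a QUADRATIC place (`KillSig2X`), PART 3 of 5:
# the ramified leaf test, the binary disc walk, rescaling / shape bit, and the pair-square lemmas
# (rank-2 observatory, cert-1 gen 40; design `b2b-bsdr2-cert-1/…/generics/sig2x/README-SIG2X.md`, census `census/sig2x/`)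

HONEST FRAMING: per-curve certified theorems and census instruments; no claim on BSD in rank ≥ 2.
PARTITION: none — rank ≥ 2 data (N3); no r ≤ 1 cell claimed.

Setting of PARTS 1–2: the cubic `F = x³ + a x² + b x + c` has exactly one root `ε ∈ ℤ₂` and an irreducible quadratic
cofactor, i.e. `ℚ₂ ⊗ K = ℚ₂ × K_w`, `K_w = ℚ₂(w)`, `w² = s₁ w + s₀` (unramified: `s₁`, `s₀` odd; ramified: `s₁ = 2d`,
`s₀ = 2c'`, `c'` odd), the image of `θ` in `K_w` being `A = p + q·w`.  This part supplies the problem-independent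
glue between the core lemmas (`core8`, `coreU`, `coreE`, `shapeE`) and the certificate checker of PART 5:

* `outMisE` / `outMisE_sound` — the leaf test at a ramified place (class mismatch by `coreE` or shape mismatch by
  `shapeE`), after the shape normalisation `wtw` (multiplication by `w^b`);
* `walk2x` / `walk2x_sound` — the binary walk over the 2-adic digits of `y = z·ρ²/n²` with an abstract leaf test;
* `quad_scale`, `wmul_rel` — rescaling the quadratic relation by an inverse of the odd part of `n`, and multiplying
  it by `w` (shape bit);
* `sqU`, `sqE` — "`2^(D+1) ∤ R ⟹ 2^(2D+1) ∤ Z·R²`" at an unramified / ramified place (the valuation anchor).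
(The index lemma, the root relations in certificate coordinates and the driver are PART 4; the checker is PART 5.)

Integer (pair) arithmetic only; no instances, no `native_decide`, sorry-free.
[cite: Cassels1991LecturesEllipticCurves, §15] [cite: CremonaAlgorithms1997, §3.6]
-/

-- single-conjunct summit: `Summit.BirchSwinnertonDyer.BirchSwinnertonDyer.…` repeats the name by design
set_option linter.dupNamespace false

namespace Summit.BirchSwinnertonDyer.BirchSwinnertonDyer.Rank2Observatory.TwoDescKill

/-! ### The leaf test at a ramified place -/

/-- Multiplication by `w^b` (`b : Bool`, `w = (0, 1)`): the shape normalisation at a ramified place. [folklore] -/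
def wtw (c d : ℤ) : Bool → ℤ × ℤ → ℤ × ℤ
  | false, x => x
  | true, x => qmul (2 * d) (2 * c) (0, 1) x

/-- `etw` only depends on the parity of its bit. [folklore] -/
theorem etw_congr (c d : ℤ) {b₁ b₂ : ℕ} (h : b₁ % 2 = b₂ % 2) (x : ℤ × ℤ) : etw c d b₁ x = etw c d b₂ x := by
  unfold etw; rw [h]

/-- `etw` respects congruences coordinate-wise. [folklore] -/
theorem etw_modEq (c d : ℤ) (b : ℕ) {m : ℤ} {x x' : ℤ × ℤ} (h₁ : x.1 ≡ x'.1 [ZMOD m]) (h₂ : x.2 ≡ x'.2 [ZMOD m]) :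
    (etw c d b x).1 ≡ (etw c d b x').1 [ZMOD m] ∧ (etw c d b x).2 ≡ (etw c d b x').2 [ZMOD m] := by
  unfold etw
  split_ifs
  · exact ⟨h₁, h₂⟩
  · exact qmul_modEq (Int.ModEq.refl _) (Int.ModEq.refl _) h₁ h₂

/-- MISMATCH AT A RAMIFIED QUADRATIC PLACE on the disc `y ≡ cc (mod 2^j)`: with `w^b·(cc − A) = 2^{m₀}·δ'`
(`psplit`) and the disc determined (`m₀ + 3 ≤ j`), either `δ'₀` is odd (a unit) and `η^{(s+m₀) mod 2}·Z⋆·δ'`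
is NOT a square mod `8` (class mismatch, `coreE`), or `δ'₀` is even and `δ'₁` odd (odd `w`-valuation against
the even `w`-valuation of `Z⋆·R²`: shape mismatch, `shapeE`). [cite: CremonaAlgorithms1997, §3.6] -/
def outMisE (c d : ℤ) (cc : ℤ) (j : ℕ) (ζ : Bool × ℕ × (ℤ × ℤ)) (A : ℤ × ℤ) : Bool :=
  let sp := psplit j (wtw c d ζ.1 (cc - A.1, -A.2))
  let δ' := sp.2
  decide (sp.1 + 3 ≤ j) &&
    ((!decide (δ'.1 % 2 = 0) &&
        !isSq8 (2 * d) (2 * c) (etw c d (ζ.2.1 + sp.1) (qmul (2 * d) (2 * c) ζ.2.2 δ'))) ||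
      (decide (δ'.1 % 2 = 0) && !decide (δ'.2 % 2 = 0)))

/-- Soundness of `outMisE`: no `y ≡ cc (mod 2^j)` satisfies the (shape-normalised) kill relation
`2^N ∣ 2^s·Z⋆·R² − 2^K·w^b·(y − A)` at the ramified place (`K` even, `K ≤ B`, `j + B + 2 < N`).
[cite: CremonaAlgorithms1997, §3.6] -/
theorem outMisE_sound {c d : ℤ} (hc : ¬ (2 : ℤ) ∣ c) {cc : ℤ} {j : ℕ} {b : Bool} {s : ℕ} {Zs A : ℤ × ℤ}
    (hZ : ¬ (2 : ℤ) ∣ Zs.1) (h : outMisE c d cc j (b, s, Zs) A = true) {B N K : ℕ} (hK : K ≤ B)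
    (hK2 : K % 2 = 0) (hj : j + B + 2 < N) {y : ℤ} (hy : (2 : ℤ) ^ j ∣ y - cc)
    (hX : ∃ R : ℤ × ℤ,
      (2 : ℤ) ^ N ∣ (2 : ℤ) ^ s * (qmul (2 * d) (2 * c) Zs (qmul (2 * d) (2 * c) R R)).1 -
          (2 : ℤ) ^ K * (wtw c d b (y - A.1, -A.2)).1 ∧
        (2 : ℤ) ^ N ∣ (2 : ℤ) ^ s * (qmul (2 * d) (2 * c) Zs (qmul (2 * d) (2 * c) R R)).2 -
          (2 : ℤ) ^ K * (wtw c d b (y - A.1, -A.2)).2) : False := by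
  obtain ⟨R, hR₁, hR₂⟩ := hX
  simp only [outMisE, Bool.and_eq_true, Bool.or_eq_true, Bool.not_eq_true', decide_eq_true_eq,
    decide_eq_false_iff_not] at h
  obtain ⟨hm, hmis⟩ := h
  obtain ⟨sp₁, sp₂⟩ := psplit_spec j (wtw c d b (cc - A.1, -A.2))
  set m₀ := (psplit j (wtw c d b (cc - A.1, -A.2))).1 with hm₀
  set δ' := (psplit j (wtw c d b (cc - A.1, -A.2))).2 with hδ'
  obtain ⟨t, ht⟩ := hy
  obtain ⟨e, he⟩ : ∃ e, j = m₀ + 3 + e := ⟨j - (m₀ + 3), by omega⟩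
  set τ : ℤ × ℤ := wtw c d b (t, 0) with hτ
  have lin : wtw c d b (y - A.1, -A.2) =
      ((wtw c d b (cc - A.1, -A.2)).1 + (2 : ℤ) ^ j * τ.1, (wtw c d b (cc - A.1, -A.2)).2 + (2 : ℤ) ^ j * τ.2) := by
    have ey : y - A.1 = (cc - A.1) + (2 : ℤ) ^ j * t := by rw [← ht]; ring
    rw [ey, hτ]
    cases b with
    | false => show _ = (_, (wtw c d false (cc - A.1, -A.2)).2 + (2 : ℤ) ^ j * (wtw c d false (t, 0)).2)
               simp only [wtw, mul_zero, add_zero]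
    | true => simp only [wtw, qmul, Prod.mk.injEq]; constructor <;> ring
  -- on the disc: `w^b (y − A) = 2^m₀ • δ''` with `δ'' ≡ δ' (mod 8)`
  set δ'' : ℤ × ℤ := (δ'.1 + (2 : ℤ) ^ (3 + e) * τ.1, δ'.2 + (2 : ℤ) ^ (3 + e) * τ.2) with hδ''
  have ey₁ : (wtw c d b (y - A.1, -A.2)).1 = (2 : ℤ) ^ m₀ * δ''.1 := by
    rw [lin, hδ'']; simp only; rw [sp₁, he]; ring
  have ey₂ : (wtw c d b (y - A.1, -A.2)).2 = (2 : ℤ) ^ m₀ * δ''.2 := by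
    rw [lin, hδ'']; simp only; rw [sp₂, he]; ring
  have c₁ : δ''.1 ≡ δ'.1 [ZMOD 8] := Int.modEq_iff_dvd.mpr ⟨-((2 : ℤ) ^ e * τ.1), by rw [hδ'']; ring⟩
  have c₂ : δ''.2 ≡ δ'.2 [ZMOD 8] := Int.modEq_iff_dvd.mpr ⟨-((2 : ℤ) ^ e * τ.2), by rw [hδ'']; ring⟩
  have eδ₁ : δ'.1 = δ''.1 - 2 * ((2 : ℤ) ^ (2 + e) * τ.1) := by rw [hδ'']; ring
  have eδ₂ : δ'.2 = δ''.2 - 2 * ((2 : ℤ) ^ (2 + e) * τ.2) := by rw [hδ'']; ring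
  have r₁ : (2 : ℤ) ^ N ∣ (2 : ℤ) ^ s * (qmul (2 * d) (2 * c) Zs (qmul (2 * d) (2 * c) R R)).1 -
      (2 : ℤ) ^ (K + m₀) * δ''.1 := by
    have e' : (2 : ℤ) ^ (K + m₀) * δ''.1 = (2 : ℤ) ^ K * (wtw c d b (y - A.1, -A.2)).1 := by
      rw [ey₁, pow_add]; ring
    rw [e']; exact hR₁
  have r₂ : (2 : ℤ) ^ N ∣ (2 : ℤ) ^ s * (qmul (2 * d) (2 * c) Zs (qmul (2 * d) (2 * c) R R)).2 -
      (2 : ℤ) ^ (K + m₀) * δ''.2 := by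
    have e' : (2 : ℤ) ^ (K + m₀) * δ''.2 = (2 : ℤ) ^ K * (wtw c d b (y - A.1, -A.2)).2 := by
      rw [ey₂, pow_add]; ring
    rw [e']; exact hR₂
  rcases hmis with ⟨hodd, hmis⟩ | ⟨hev, hodd₂⟩
  · have hodd'' : ¬ (2 : ℤ) ∣ δ''.1 := by
      intro h1; apply hodd
      apply Int.emod_eq_zero_of_dvd
      rw [eδ₁]; exact dvd_sub h1 (dvd_mul_right _ _)
    have hsq := coreE (d := d) hc hZ hodd'' (K + m₀) s N R (by omega) r₁ r₂
    have hpar : (s + (K + m₀)) % 2 = (s + m₀) % 2 := by omega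
    rw [etw_congr c d hpar] at hsq
    obtain ⟨p₁, p₂⟩ := qmul_modEq (s₁ := 2 * d) (s₀ := 2 * c) (Int.ModEq.refl Zs.1) (Int.ModEq.refl Zs.2) c₁ c₂
    obtain ⟨q₁, q₂⟩ := etw_modEq c d (s + m₀) p₁ p₂
    rw [isSq8_congr q₁ q₂] at hsq
    rw [hsq] at hmis
    exact Bool.noConfusion hmis
  · have hev'' : (2 : ℤ) ∣ δ''.1 := by
      have e' : δ''.1 = δ'.1 + 2 * ((2 : ℤ) ^ (2 + e) * τ.1) := by rw [hδ'']; ring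
      rw [e']; exact dvd_add (Int.dvd_of_emod_eq_zero hev) (dvd_mul_right _ _)
    have hodd'' : ¬ (2 : ℤ) ∣ δ''.2 := by
      intro h2; apply hodd₂
      apply Int.emod_eq_zero_of_dvd
      rw [eδ₂]; exact dvd_sub h2 (dvd_mul_right _ _)
    exact shapeE (d := d) hc hZ hev'' hodd'' (K + m₀) s N R (by omega) r₁ r₂

/-! ### The binary disc walk with an abstract leaf test -/

/-- The binary disc walk below the node `(c, j)` with an abstract leaf test, fuelled, guard `j + B + 2 < N`. [folklore] -/
def walk2x (leaf : ℤ → ℕ → Bool) (B N : ℕ) : ℕ → ℤ → ℕ → Bool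
  | 0, c, j => decide (j + B + 2 < N) && leaf c j
  | f + 1, c, j =>
      decide (j + B + 2 < N) &&
        (leaf c j || (walk2x leaf B N f c (j + 1) && walk2x leaf B N f (c + (2 : ℤ) ^ j) (j + 1)))

/-- A certified walk node satisfies the guard `j + B + 2 < N`. [folklore] -/
theorem walk2x_guard {leaf : ℤ → ℕ → Bool} {B N : ℕ} :
    ∀ {f : ℕ} {c : ℤ} {j : ℕ}, walk2x leaf B N f c j = true → j + B + 2 < N
  | 0, c, j, h => by
      simp only [walk2x, Bool.and_eq_true, decide_eq_true_eq] at h; exact h.1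
  | f + 1, c, j, h => by
      simp only [walk2x, Bool.and_eq_true, decide_eq_true_eq] at h; exact h.1

/-- Soundness of the abstract walk: if the leaf test at `(c, j)` (with the guard) refutes every `y ≡ c (mod 2^j)`
satisfying `P`, then a certified walk from `(c, j)` refutes every such `y`. [folklore] -/
theorem walk2x_sound {leaf : ℤ → ℕ → Bool} {B N : ℕ} {P : ℤ → Prop}
    (hleaf : ∀ (c : ℤ) (j : ℕ), leaf c j = true → j + B + 2 < N → ∀ y : ℤ, (2 : ℤ) ^ j ∣ y - c → P y → False) :
    ∀ (f : ℕ) (c : ℤ) (j : ℕ), walk2x leaf B N f c j = true → ∀ y : ℤ, (2 : ℤ) ^ j ∣ y - c → P y → False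
  | 0, c, j, h, y, hy, hP => by
      simp only [walk2x, Bool.and_eq_true, decide_eq_true_eq] at h
      exact hleaf c j h.2 h.1 y hy hP
  | f + 1, c, j, h, y, hy, hP => by
      simp only [walk2x, Bool.and_eq_true, Bool.or_eq_true, decide_eq_true_eq] at h
      obtain ⟨hj, h | ⟨h₁, h₂⟩⟩ := h
      · exact hleaf c j h hj y hy hP
      · -- digit split: `y − c = 2^j·t`, `t` even or odd
        obtain ⟨t, ht⟩ := hy
        rcases Int.even_or_odd t with ⟨k, hk⟩ | ⟨k, hk⟩
        · refine walk2x_sound hleaf f c (j + 1) h₁ y ⟨k, ?_⟩ hP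
          rw [ht, hk, pow_succ]; ring
        · refine walk2x_sound hleaf f (c + (2 : ℤ) ^ j) (j + 1) h₂ y ⟨k, ?_⟩ hP
          have : y - (c + (2 : ℤ) ^ j) = (y - c) - (2 : ℤ) ^ j := by ring
          rw [this, ht, hk, pow_succ]; ring

/-! ### Scaling and the shape bit -/

/-- `w^b` is `ℤ`-linear. [folklore] -/
theorem wtw_smul (c d : ℤ) (b : Bool) (k : ℤ) (x : ℤ × ℤ) :
    wtw c d b (k * x.1, k * x.2) = (k * (wtw c d b x).1, k * (wtw c d b x).2) := by
  cases b with
  | false => simp only [wtw]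
  | true => simp only [wtw, qmul, Prod.mk.injEq]; constructor <;> ring

/-- `w^b` respects congruences coordinate-wise. [folklore] -/
theorem wtw_modEq (c d : ℤ) (b : Bool) {m : ℤ} {x x' : ℤ × ℤ} (h₁ : x.1 ≡ x'.1 [ZMOD m])
    (h₂ : x.2 ≡ x'.2 [ZMOD m]) :
    (wtw c d b x).1 ≡ (wtw c d b x').1 [ZMOD m] ∧ (wtw c d b x).2 ≡ (wtw c d b x').2 [ZMOD m] := by
  cases b with
  | false => exact ⟨h₁, h₂⟩
  | true => exact qmul_modEq (Int.ModEq.refl _) (Int.ModEq.refl _) h₁ h₂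

/-- `w^b` preserves coordinate-wise divisibility. [folklore] -/
theorem wtw_dvd (c d : ℤ) (b : Bool) {m : ℤ} {x : ℤ × ℤ} (h₁ : m ∣ x.1) (h₂ : m ∣ x.2) :
    m ∣ (wtw c d b x).1 ∧ m ∣ (wtw c d b x).2 := by
  cases b with
  | false => exact ⟨h₁, h₂⟩
  | true => exact dvd_qmul (0, 1) h₁ h₂

/-- RESCALING the quadratic relation: from `2^N ∣ 2^s·Z·R² − 2^K·w^b·(w₁ − n'²·Ê, …)` and `m·n' + k·2^N = 1`, the
walk relation for `y = w₁·m²`, `R ↦ m·R`: `2^N ∣ 2^s·Z·(mR)² − 2^K·w^b·(y − Ê)` coordinate-wise. [folklore] -/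
theorem quad_scale {s₁ s₀ cw dw : ℤ} {b : Bool} {N s K : ℕ} {Z R E : ℤ × ℤ} {w₁ n' m k : ℤ}
    (hmk : m * n' + k * (2 : ℤ) ^ N = 1)
    (h₁ : (2 : ℤ) ^ N ∣ (2 : ℤ) ^ s * (qmul s₁ s₀ Z (qmul s₁ s₀ R R)).1 -
      (2 : ℤ) ^ K * (wtw cw dw b (w₁ - n' ^ 2 * E.1, -(n' ^ 2 * E.2))).1)
    (h₂ : (2 : ℤ) ^ N ∣ (2 : ℤ) ^ s * (qmul s₁ s₀ Z (qmul s₁ s₀ R R)).2 -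
      (2 : ℤ) ^ K * (wtw cw dw b (w₁ - n' ^ 2 * E.1, -(n' ^ 2 * E.2))).2) :
    (2 : ℤ) ^ N ∣ (2 : ℤ) ^ s * (qmul s₁ s₀ Z (qmul s₁ s₀ (m * R.1, m * R.2) (m * R.1, m * R.2))).1 -
        (2 : ℤ) ^ K * (wtw cw dw b (w₁ * m ^ 2 - E.1, -E.2)).1 ∧
      (2 : ℤ) ^ N ∣ (2 : ℤ) ^ s * (qmul s₁ s₀ Z (qmul s₁ s₀ (m * R.1, m * R.2) (m * R.1, m * R.2))).2 -
        (2 : ℤ) ^ K * (wtw cw dw b (w₁ * m ^ 2 - E.1, -E.2)).2 := by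
  obtain ⟨t₁, ht₁⟩ := h₁
  obtain ⟨t₂, ht₂⟩ := h₂
  cases b with
  | false =>
    simp only [wtw, qmul] at ht₁ ht₂ ⊢
    exact ⟨⟨m ^ 2 * t₁ + (2 : ℤ) ^ K * E.1 * k * (1 + m * n'), by
        linear_combination m ^ 2 * ht₁ - (2 : ℤ) ^ K * E.1 * (1 + m * n') * hmk⟩,
      ⟨m ^ 2 * t₂ + (2 : ℤ) ^ K * E.2 * k * (1 + m * n'), by
        linear_combination m ^ 2 * ht₂ - (2 : ℤ) ^ K * E.2 * (1 + m * n') * hmk⟩⟩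
  | true =>
    simp only [wtw, qmul] at ht₁ ht₂ ⊢
    exact ⟨⟨m ^ 2 * t₁ + (2 : ℤ) ^ K * (2 * cw * E.2) * k * (1 + m * n'), by
        linear_combination m ^ 2 * ht₁ - (2 : ℤ) ^ K * (2 * cw * E.2) * (1 + m * n') * hmk⟩,
      ⟨m ^ 2 * t₂ + (2 : ℤ) ^ K * (E.1 + 2 * dw * E.2) * k * (1 + m * n'), by
        linear_combination m ^ 2 * ht₂ - (2 : ℤ) ^ K * (E.1 + 2 * dw * E.2) * (1 + m * n') * hmk⟩⟩

/-- THE SHAPE BIT: if `w·Z' = 2·Z⋆` (i.e. `Z'₀` even), multiplying `2^N ∣ 2^s·Z'·X − V` by `w` gives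
`2^N ∣ 2^(s+1)·Z⋆·X − w·V` coordinate-wise. [folklore] -/
theorem wmul_rel {c d : ℤ} {N s : ℕ} {Z' Zs X V : ℤ × ℤ} (hZ₁ : (2 : ℤ) * Zs.1 = Z'.2 * (2 * c))
    (hZ₂ : (2 : ℤ) * Zs.2 = Z'.1 + Z'.2 * (2 * d))
    (h₁ : (2 : ℤ) ^ N ∣ (2 : ℤ) ^ s * (qmul (2 * d) (2 * c) Z' X).1 - V.1)
    (h₂ : (2 : ℤ) ^ N ∣ (2 : ℤ) ^ s * (qmul (2 * d) (2 * c) Z' X).2 - V.2) :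
    (2 : ℤ) ^ N ∣ (2 : ℤ) ^ (s + 1) * (qmul (2 * d) (2 * c) Zs X).1 - (wtw c d true V).1 ∧
      (2 : ℤ) ^ N ∣ (2 : ℤ) ^ (s + 1) * (qmul (2 * d) (2 * c) Zs X).2 - (wtw c d true V).2 := by
  obtain ⟨k₁, hk₁⟩ := h₁
  obtain ⟨k₂, hk₂⟩ := h₂
  simp only [wtw, qmul] at hk₁ hk₂ ⊢
  refine ⟨⟨k₂ * (2 * c), ?_⟩, ⟨k₁ + k₂ * (2 * d), ?_⟩⟩
  · rw [pow_succ]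
    linear_combination ((2 : ℤ) ^ s * X.1) * hZ₁ + ((2 : ℤ) ^ s * X.2 * (2 * c)) * hZ₂ + (2 * c) * hk₂
  · rw [pow_succ]
    linear_combination ((2 : ℤ) ^ s * X.2) * hZ₁ + ((2 : ℤ) ^ s * X.1 + (2 : ℤ) ^ s * X.2 * (2 * d)) * hZ₂ +
      hk₁ + (2 * d) * hk₂

/-! ### The pair-square lemmas (valuation anchor at the quadratic place) -/

/-- `Z·(2R̃)² = 4·Z·R̃²` coordinate-wise. [folklore] -/
theorem qmul_scale (s₁ s₀ m : ℤ) (Z R : ℤ × ℤ) :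
    (qmul s₁ s₀ Z (qmul s₁ s₀ (m * R.1, m * R.2) (m * R.1, m * R.2))).1 =
        m ^ 2 * (qmul s₁ s₀ Z (qmul s₁ s₀ R R)).1 ∧
      (qmul s₁ s₀ Z (qmul s₁ s₀ (m * R.1, m * R.2) (m * R.1, m * R.2))).2 =
        m ^ 2 * (qmul s₁ s₀ Z (qmul s₁ s₀ R R)).2 := by
  simp only [qmul]; constructor <;> ring

/-- UNRAMIFIED pair-square lemma: `Z` primitive and `2^(D+1) ∤ R` (not both coordinates) ⟹ `2^(2D+1) ∤ Z·R²`
(not both coordinates): `v_w(Z·R²) = 2·v_w(R) ≤ 2D`. [folklore] -/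
theorem sqU {s₁ s₀ : ℤ} (hs₁ : ¬ (2 : ℤ) ∣ s₁) (hs₀ : ¬ (2 : ℤ) ∣ s₀) {Z : ℤ × ℤ}
    (hZ : ¬ ((2 : ℤ) ∣ Z.1 ∧ (2 : ℤ) ∣ Z.2)) (D : ℕ) :
    ∀ R : ℤ × ℤ, ¬ ((2 : ℤ) ^ (D + 1) ∣ R.1 ∧ (2 : ℤ) ^ (D + 1) ∣ R.2) →
      ¬ ((2 : ℤ) ^ (2 * D + 1) ∣ (qmul s₁ s₀ Z (qmul s₁ s₀ R R)).1 ∧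
          (2 : ℤ) ^ (2 * D + 1) ∣ (qmul s₁ s₀ Z (qmul s₁ s₀ R R)).2) := by
  induction D with
  | zero =>
    intro R hR h
    simp only [zero_add, pow_one, mul_zero] at hR h
    exact unr_domain hs₁ hs₀ hZ (unr_domain hs₁ hs₀ hR hR) h
  | succ D ih =>
    intro R hR h
    by_cases hR2 : (2 : ℤ) ∣ R.1 ∧ (2 : ℤ) ∣ R.2
    · obtain ⟨⟨x, hx⟩, ⟨y, hy⟩⟩ := hR2
      have hR' : ¬ ((2 : ℤ) ^ (D + 1) ∣ x ∧ (2 : ℤ) ^ (D + 1) ∣ y) := by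
        rintro ⟨h1, h2⟩
        exact hR ⟨by rw [hx, pow_succ']; exact mul_dvd_mul_left 2 h1,
          by rw [hy, pow_succ']; exact mul_dvd_mul_left 2 h2⟩
      have eR : R = (2 * (x, y).1, 2 * (x, y).2) := Prod.ext hx hy
      obtain ⟨e₁, e₂⟩ := qmul_scale s₁ s₀ 2 Z (x, y)
      rw [eR, e₁, e₂, show 2 * (D + 1) + 1 = (2 * D + 1) + 2 by ring] at h
      exact ih (x, y) hR' ⟨pow_dvd_cancel h.1, pow_dvd_cancel h.2⟩
    · have h2 : (2 : ℤ) ∣ (2 : ℤ) ^ (2 * (D + 1) + 1) := dvd_pow_self 2 (by omega)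
      exact unr_domain hs₁ hs₀ hZ (unr_domain hs₁ hs₀ hR2 hR2) ⟨h2.trans h.1, h2.trans h.2⟩

/-- RAMIFIED base case (`c` odd, `Z₀` odd, `R` primitive): `4 ∤ (Z·R²)₀` (`R₀` odd gives an odd value,
`R₀` even and `R₁` odd give `2·odd`). [folklore] -/
theorem sqE_base {c d : ℤ} (hc : ¬ (2 : ℤ) ∣ c) {Z : ℤ × ℤ} (hZ : ¬ (2 : ℤ) ∣ Z.1) (R : ℤ × ℤ)
    (hR : ¬ ((2 : ℤ) ∣ R.1 ∧ (2 : ℤ) ∣ R.2)) :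
    ¬ (2 : ℤ) ^ 2 ∣ (qmul (2 * d) (2 * c) Z (qmul (2 * d) (2 * c) R R)).1 := by
  intro h
  rcases Int.even_or_odd R.1 with ⟨x, hx⟩ | hodd
  · -- `R₀ = x + x` even, so `R₁` odd: `(Z·R²)₀ = 2·(odd)`
    have hR₂ : ¬ (2 : ℤ) ∣ R.2 := fun h2 => hR ⟨⟨x, by rw [hx]; ring⟩, h2⟩
    have e : (qmul (2 * d) (2 * c) Z (qmul (2 * d) (2 * c) R R)).1 =
        2 * (Z.1 * (2 * x ^ 2 + c * R.2 ^ 2) + 2 * (c * Z.2 * (2 * x * R.2 + d * R.2 ^ 2))) := by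
      simp only [qmul]; rw [hx]; ring
    rw [e, show (2 : ℤ) ^ 2 = 2 * 2 by norm_num] at h
    have h' := (mul_dvd_mul_iff_left (by norm_num : (2 : ℤ) ≠ 0)).mp h
    have h'' : (2 : ℤ) ∣ Z.1 * (2 * x ^ 2 + c * R.2 ^ 2) := by
      have := dvd_sub h' (dvd_mul_right 2 (c * Z.2 * (2 * x * R.2 + d * R.2 ^ 2)))
      simpa using this
    revert h''
    simp only [imp_false, ← even_iff_two_dvd, Int.even_add, Int.even_mul, Int.even_pow, even_two, true_or,
      iff_true] at *
    tauto
  · -- `R₀` odd: `(Z·R²)₀` odd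
    have h2 : (2 : ℤ) ∣ (qmul (2 * d) (2 * c) Z (qmul (2 * d) (2 * c) R R)).1 :=
      (dvd_pow_self 2 (by omega)).trans h
    have hodd' : ¬ (2 : ℤ) ∣ R.1 := by
      rw [← even_iff_two_dvd, ← Int.not_odd_iff_even, not_not]; exact hodd
    apply hodd'
    simp only [qmul, ← even_iff_two_dvd, Int.even_add, Int.even_mul, even_two, true_or, or_true,
      iff_true] at *
    tauto

/-- RAMIFIED pair-square lemma (`c` odd, `Z₀` odd): `2^(D+1) ∤ R` (not both coordinates) ⟹
`2^(2D+2) ∤ (Z·R²)₀`: `v_w(Z·R²) = 2·v_w(R) ≤ 4D + 2`, i.e. `v₂` of the first coordinate is `≤ 2D + 1`.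
[folklore] -/
theorem sqE {c d : ℤ} (hc : ¬ (2 : ℤ) ∣ c) {Z : ℤ × ℤ} (hZ : ¬ (2 : ℤ) ∣ Z.1) (D : ℕ) :
    ∀ R : ℤ × ℤ, ¬ ((2 : ℤ) ^ (D + 1) ∣ R.1 ∧ (2 : ℤ) ^ (D + 1) ∣ R.2) →
      ¬ (2 : ℤ) ^ (2 * D + 2) ∣ (qmul (2 * d) (2 * c) Z (qmul (2 * d) (2 * c) R R)).1 := by
  induction D with
  | zero =>
    intro R hR
    simp only [zero_add, pow_one, mul_zero] at hR ⊢
    exact sqE_base hc hZ R hR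
  | succ D ih =>
    intro R hR h
    by_cases hR2 : (2 : ℤ) ∣ R.1 ∧ (2 : ℤ) ∣ R.2
    · obtain ⟨⟨x, hx⟩, ⟨y, hy⟩⟩ := hR2
      have hR' : ¬ ((2 : ℤ) ^ (D + 1) ∣ x ∧ (2 : ℤ) ^ (D + 1) ∣ y) := by
        rintro ⟨h1, h2⟩
        exact hR ⟨by rw [hx, pow_succ']; exact mul_dvd_mul_left 2 h1,
          by rw [hy, pow_succ']; exact mul_dvd_mul_left 2 h2⟩
      have eR : R = (2 * (x, y).1, 2 * (x, y).2) := Prod.ext hx hy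
      obtain ⟨e₁, -⟩ := qmul_scale (2 * d) (2 * c) 2 Z (x, y)
      rw [eR, e₁, show 2 * (D + 1) + 2 = (2 * D + 2) + 2 by ring] at h
      exact ih (x, y) hR' (pow_dvd_cancel h)
    · exact sqE_base hc hZ R hR2 ((pow_dvd_pow 2 (by omega)).trans h)

end Summit.BirchSwinnertonDyer.BirchSwinnertonDyer.Rank2Observatory.TwoDescKill
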